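import Summits.BirchSwinnertonDyer.Rank1Residual.Additive.KatoDescentKatoRigidCharacterValues
import Literature.NumberTheory.EllipticCurves.Kato2004.ZetaBodyFrameRotationProofs
import HarnessLib

set_option autoImplicit false

/-!
# AUG engine, step 3: the level identity of a collinear pair read through the VALUE LAW (C5) of both families and the
# rotation `ι₁ = ι₂ ∘ σ_a` of their complex frames — `r_F(u − 1)·(e • (1 ⊗ κ₁·L₁(χ)/Ω⁺·𝒸₁(χ))) = r_G(u − 1)·(1 ⊗ χ̄(a)·κ₂·L₂(χ)/Ω⁺·𝒸₂(χ))`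
# in `ℚ_p ⊗_ℚ ℂ` (seat `bsd-cm-prr-ty1` g14, cell `bsd-cm`; theorems only: no definition, no named fact, no instance, no `sorry`)

Part 45 of the seat's kernel cut of stub 3 (cruxes stmt-BirchSwinnertonDyer-19945 / -19223).  Part 44 (E31
`KatoDescentKatoRigidCharacterValues`) gave, for two `ZetaBody` families of one newform lifted into one pin with `Λ₂ = e • Λ₁` and a
collinearity `F • y₁ = G • y₂`, and for every character `χ` of `Gal(ℚ_n/ℚ)` and ONE embedding `ι`:
`r_F(u − 1)·(e • (1 ⊗ charSum_ι χ x₁)) = r_G(u − 1)·(1 ⊗ charSum_ι χ x₂)`.  The value law (C5) of family `i` reads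
`charSum_{ιᵢ} χ xᵢ` through ITS OWN frame `ιᵢ`; two frames differ by Kato's `σ_a` (`exists_units_ringHom_comp_sigma_eq`:
`ι₂ ∘ σ_a = ι₁` at the level `m = p^{n+1}`), and `charSum_{ι₁} χ x₂ = χ̄(a) · charSum_{ι₂} χ x₂`
(`charSum_sigma_of_comp_eq`, `CharSum.charSum_sigma`).  THIS FILE substitutes (C5) (even `χ`; the characters of `Gal(ℚ_n/ℚ)`
are even) for both families:
* `charSum_eq_inv_mul_of_comp_eq` — the frame change `charSum_{ι₁} χ x = χ⁻¹(a)·charSum_{ι₂} χ x`;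
* ★ `aeval_mul_values_eq_of_smul_eq_smul` — under E31's hypotheses with `ι = ι₁(m)`, for even `χ`, Kato's guards
  `(cᵢdᵢ, m·Aᵢ) = 1`, `dᵢd′ᵢ ≡ 1 (Aᵢ)` and entire continuations `Lᵢ` of the `p·Aᵢ`-depleted twisted series of `χ`
  (`IsDepletedTwistedL`): **`r_F(u − 1)·(e • (1 ⊗ κ₁·(L₁(1)/Ω⁺_f)·𝒸⁻_χ̄(π₁))) = r_G(u − 1)·(1 ⊗ χ⁻¹(a)·(κ₂·(L₂(1)/Ω⁺_f)·𝒸⁻_χ̄(π₂)))`**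
  in `ℚ_p ⊗_ℚ ℂ`, `u = 1 ⊗ χ⁻¹(χ_cyc γ)`, `𝒸⁻_χ̄(πᵢ) = cuspFactor f true (χ⁻¹ ∘ ·) cᵢ dᵢ aᵢ Aᵢ d′ᵢ`.
This is Kato §13.9's comparison «by using Thm 6.6 and Thm 9.7» at ONE character.  NEXT (successor; HOME `STUB3-CUT.md` §6
addendum 6): the two depletions `p·A₁` vs `p·A₂` (Euler factors at `ℓ ∣ A₁A₂`), the cusp factors as Iwasawa functions, the
coherence of `a = a_m` across levels (imprimitive characters + Rohrlich), Weierstrass ⇒ AUG.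
HONEST LABEL: theorems about the tree's readings ((C5) is a clause of the HYPOTHESIS `ZetaBody`); nothing about Kato's classes,
Kato's Main Conjecture or Perrin-Riou is asserted; AUG stays displayed; no stub is closed; nothing is asserted on 19945 / 19223;
BSD is not proved for any curve.
References: [Kato2004Asterisque] (5.7.1) (p. 157), Thm. 6.6 (1) (p. 163), Thm. 9.7 (p. 189), §13.8 (p. 228), §13.9 (p. 230);
[Washington1997] Ch. 2 (Thm. 2.5), §13.2.
-/

noncomputable section

open scoped BigOperators NumberField TensorProduct
open Polynomial Field IsDedekindDomain CongruenceSubgroup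
open Literature.NumberTheory.GaloisRepresentations
open Literature.NumberTheory.EllipticCurves Literature.NumberTheory.EllipticCurves.ModularForms
open Literature.NumberTheory.EllipticCurves.Kato2004 Literature.NumberTheory.EllipticCurves.Kato2004.EulerSystemValues
open Rat.HeightOneSpectrum
open Summit.BirchSwinnertonDyer.Rank1Residual.GaloisImage

namespace Summit.BirchSwinnertonDyer.Rank1Residual.Additive.PerrinRiouUnit

/-! ## §1 The frame change -/

section Frame

variable {m : ℕ} [NeZero m]

/-- **`charSum_{ι₁} χ x = χ⁻¹(a) · charSum_{ι₂} χ x` when `ι₂ ∘ σ_a = ι₁`** (`charSum_sigma_of_comp_eq` + the translation law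
`CharSum.charSum_sigma`). [cite: Kato2004Asterisque, Thm. 6.6 (1) (p. 163) and (5.7.1) (p. 157)] -/
theorem charSum_eq_inv_mul_of_comp_eq {ι₁ ι₂ : CyclotomicField m ℚ →+* ℂ} {a : (ZMod m)ˣ}
    (ha : ∀ y, ι₂ (sigma m a y) = ι₁ y) (χ : DirichletCharacter ℂ m) (x : CyclotomicField m ℚ) :
    charSum m ι₁ χ x = χ⁻¹ (a : ZMod m) * charSum m ι₂ χ x := by
  rw [← charSum_sigma_of_comp_eq ha χ x, CharSum.charSum_sigma]

end Frame

/-! ## §2 The value law substituted -/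

section Values

variable {W : WeierstrassCurve ℚ} [W.IsElliptic] {p : ℕ} [Fact p.Prime] [ContinuousSMul ℤ_[p] (W.tateModule p)]
  [Module.Free ℤ_[p] (W.tateModule p)] [Module.Finite ℤ_[p] (W.tateModule p)]
  {N : ℕ} {f : CuspForm (Gamma0 N) 2} {ι₁ ι₂ : (m : ℕ) → (CyclotomicField m ℚ →+* ℂ)} {κ₁ κ₂ : ℝ}
  {Λ₁ Λ₂ : ∀ (k : ℕ) (r : Finset (HeightOneSpectrum (𝓞 ℚ))),
    H1 (tateRep W p) (cycSubgroup p k r) →ₗ[ℤ_[p]] ℚ_[p] ⊗[ℚ] CyclotomicField (cycLevel p k r) ℚ}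
  {c₁ d₁ a₁ : ℤ} {A₁ : ℕ} {c₂ d₂ a₂ : ℤ} {A₂ : ℕ}
  {z₁ : ∀ (k : ℕ) (r : (cyclotomicLevelsRat p (badPlaces c₁ d₁ A₁ N)).Ideals),
    H1 (tateRep W p) ((cyclotomicLevelsRat p (badPlaces c₁ d₁ A₁ N)).level k r.1)}
  {x₁ : ∀ (k : ℕ) (r : (cyclotomicLevelsRat p (badPlaces c₁ d₁ A₁ N)).Ideals), CyclotomicField (cycLevel p k r.1) ℚ}
  {z₂ : ∀ (k : ℕ) (r : (cyclotomicLevelsRat p (badPlaces c₂ d₂ A₂ N)).Ideals),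
    H1 (tateRep W p) ((cyclotomicLevelsRat p (badPlaces c₂ d₂ A₂ N)).level k r.1)}
  {x₂ : ∀ (k : ℕ) (r : (cyclotomicLevelsRat p (badPlaces c₂ d₂ A₂ N)).Ideals), CyclotomicField (cycLevel p k r.1) ℚ}
  {K : ZpExtension ℚ p} {γ : absoluteGaloisGroup ℚ}

/-- **The level identity of a collinear pair through the value laws of both families and the frame rotation.**
Under the hypotheses of E31 `aeval_mul_charSum_eq_of_smul_eq_smul` read at the embedding `ι₁(p^{n+1})` of family 1, for an
EVEN character `χ` of `Gal(ℚ_n/ℚ)`, Kato's guards and entire continuations `L₁, L₂` of the `p·A₁`- resp. `p·A₂`-depleted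
twisted series (the (C5) data of the two `ZetaBody` hypotheses), and a frame rotation `ι₂ ∘ σ_a = ι₁` at level `p^{n+1}`:
`r_F(u − 1)·(e • (1 ⊗ κ₁·(L₁(1)/Ω⁺_f)·𝒸⁻_χ̄(π₁))) = r_G(u − 1)·(1 ⊗ χ⁻¹(a)·(κ₂·(L₂(1)/Ω⁺_f)·𝒸⁻_χ̄(π₂)))` in `ℚ_p ⊗_ℚ ℂ`.
[cite: Kato2004Asterisque, Thm. 6.6 (1) (p. 163), Thm. 9.7 (p. 189), §13.9 (p. 230)] [cite: Washington1997, Ch. 2 Thm. 2.5] -/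
theorem aeval_mul_values_eq_of_smul_eq_smul (hb₁ : ZetaBody W p f ι₁ κ₁ Λ₁ c₁ d₁ a₁ A₁ z₁ x₁)
    (hb₂ : ZetaBody W p f ι₂ κ₂ Λ₂ c₂ d₂ a₂ A₂ z₂ x₂) (hK : K.IsCyclotomic) (hp : p ≠ 2) (hγ : K.IsTopGenerator γ)
    (I : IwasawaH1Data W p K γ) (n : ℕ) {y₁ y₂ : I.H}
    (hy₁ : I.proj n y₁ = levelToLayer W p hK hp (badPlaces c₁ d₁ A₁ N) n
      (z₁ (n + 1) (cyclotomicLevelsRat p (badPlaces c₁ d₁ A₁ N)).idealOne))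
    (hy₂ : I.proj n y₂ = levelToLayer W p hK hp (badPlaces c₂ d₂ A₂ N) n
      (z₂ (n + 1) (cyclotomicLevelsRat p (badPlaces c₂ d₂ A₂ N)).idealOne))
    {e : ℚ_[p]} (hΛ : ∀ y : H1 (tateRep W p) (cycSubgroup p (n + 1) ∅), Λ₂ (n + 1) ∅ y = e • Λ₁ (n + 1) ∅ y)
    {F G : IwasawaAlgebra p} {rF rG : ℤ_[p][X]}
    (hF : F - (rF : PowerSeries ℤ_[p]) ∈
      Ideal.span {(((Polynomial.X + 1 : ℤ_[p][X]) ^ p ^ n - 1 : ℤ_[p][X]) : PowerSeries ℤ_[p])})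
    (hG : G - (rG : PowerSeries ℤ_[p]) ∈
      Ideal.span {(((Polynomial.X + 1 : ℤ_[p][X]) ^ p ^ n - 1 : ℤ_[p][X]) : PowerSeries ℤ_[p])})
    (hFG : F • y₁ = G • y₂)
    (χ : DirichletCharacter ℂ (cycLevel p (n + 1) ∅))
    (hχ : ∀ σ ∈ K.layerSubgroup n,
      χ ((modNCyclotomicCharacter ℚ (cycLevel p (n + 1) ∅) σ : (ZMod (cycLevel p (n + 1) ∅))ˣ) :
        ZMod (cycLevel p (n + 1) ∅)) = 1)
    (heven : χ (-1) = 1)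
    {ev : ℚ_[p] ⊗[ℚ] CyclotomicField (cycLevel p (n + 1) ∅) ℚ →ₗ[ℚ_[p]] ℚ_[p] ⊗[ℚ] ℂ}
    (hev : ∀ (s : ℚ_[p]) (x : CyclotomicField (cycLevel p (n + 1) ∅) ℚ),
      ev (s ⊗ₜ[ℚ] x) = s ⊗ₜ[ℚ] charSum (cycLevel p (n + 1) ∅) (ι₁ (cycLevel p (n + 1) ∅)) χ x)
    {a : (ZMod (cycLevel p (n + 1) ∅))ˣ}
    (ha : ∀ y, ι₂ (cycLevel p (n + 1) ∅) (sigma (cycLevel p (n + 1) ∅) a y) = ι₁ (cycLevel p (n + 1) ∅) y)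
    (d'₁ d'₂ : ℤ) (hcd₁ : Int.gcd (c₁ * d₁) (cycLevel p (n + 1) ∅ * A₁) = 1) (hdd₁ : d₁ * d'₁ ≡ 1 [ZMOD (A₁ : ℤ)])
    (hcd₂ : Int.gcd (c₂ * d₂) (cycLevel p (n + 1) ∅ * A₂) = 1) (hdd₂ : d₂ * d'₂ ≡ 1 [ZMOD (A₂ : ℤ)])
    {L₁ L₂ : ℂ → ℂ} (hL₁ : IsDepletedTwistedL f (cycLevel p (n + 1) ∅) (p * A₁) χ L₁)
    (hL₂ : IsDepletedTwistedL f (cycLevel p (n + 1) ∅) (p * A₂) χ L₂) :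
    aeval (((1 : ℚ_[p]) ⊗ₜ[ℚ] χ⁻¹ ((modNCyclotomicCharacter ℚ (cycLevel p (n + 1) ∅) γ : (ZMod (cycLevel p (n + 1) ∅))ˣ) :
        ZMod (cycLevel p (n + 1) ∅)) : ℚ_[p] ⊗[ℚ] ℂ) - 1) rF *
        (e • ((1 : ℚ_[p]) ⊗ₜ[ℚ] ((κ₁ : ℂ) * (L₁ 1 / (plusPeriod f : ℂ)) *
          cuspFactor f true (fun k ↦ χ⁻¹ (k : ZMod (cycLevel p (n + 1) ∅))) c₁ d₁ a₁ A₁ d'₁))) =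
      aeval (((1 : ℚ_[p]) ⊗ₜ[ℚ] χ⁻¹ ((modNCyclotomicCharacter ℚ (cycLevel p (n + 1) ∅) γ : (ZMod (cycLevel p (n + 1) ∅))ˣ) :
        ZMod (cycLevel p (n + 1) ∅)) : ℚ_[p] ⊗[ℚ] ℂ) - 1) rG *
        ((1 : ℚ_[p]) ⊗ₜ[ℚ] (χ⁻¹ (a : ZMod (cycLevel p (n + 1) ∅)) * ((κ₂ : ℂ) * (L₂ 1 / (plusPeriod f : ℂ)) *
          cuspFactor f true (fun k ↦ χ⁻¹ (k : ZMod (cycLevel p (n + 1) ∅))) c₂ d₂ a₂ A₂ d'₂))) := by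
  -- (C5) for both families at level `(n+1, 𝟙)`, in the `∅`-typed form
  have h5₁ : charSum (cycLevel p (n + 1) ∅) (ι₁ (cycLevel p (n + 1) ∅)) χ
      (x₁ (n + 1) (cyclotomicLevelsRat p (badPlaces c₁ d₁ A₁ N)).idealOne) =
      (κ₁ : ℂ) * (L₁ 1 / (plusPeriod f : ℂ)) *
        cuspFactor f true (fun k ↦ χ⁻¹ (k : ZMod (cycLevel p (n + 1) ∅))) c₁ d₁ a₁ A₁ d'₁ :=
    ((hb₁.2.2.2.2.2) (n + 1) (cyclotomicLevelsRat p (badPlaces c₁ d₁ A₁ N)).idealOne d'₁ χ L₁ hcd₁ hdd₁ hL₁).1 heven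
  have h5₂ : charSum (cycLevel p (n + 1) ∅) (ι₂ (cycLevel p (n + 1) ∅)) χ
      (x₂ (n + 1) (cyclotomicLevelsRat p (badPlaces c₂ d₂ A₂ N)).idealOne) =
      (κ₂ : ℂ) * (L₂ 1 / (plusPeriod f : ℂ)) *
        cuspFactor f true (fun k ↦ χ⁻¹ (k : ZMod (cycLevel p (n + 1) ∅))) c₂ d₂ a₂ A₂ d'₂ :=
    ((hb₂.2.2.2.2.2) (n + 1) (cyclotomicLevelsRat p (badPlaces c₂ d₂ A₂ N)).idealOne d'₂ χ L₂ hcd₂ hdd₂ hL₂).1 heven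
  -- E31 at the frame `ι₁`, then the frame change for family 2
  have h := aeval_mul_charSum_eq_of_smul_eq_smul hb₁ hb₂ hK hp hγ I n hy₁ hy₂ hΛ hF hG hFG χ hχ
    (ι₁ (cycLevel p (n + 1) ∅)) hev
  rw [h5₁, charSum_eq_inv_mul_of_comp_eq ha χ (x₂ (n + 1) (cyclotomicLevelsRat p (badPlaces c₂ d₂ A₂ N)).idealOne),
    h5₂] at h
  exact h

end Values

end Summit.BirchSwinnertonDyer.Rank1Residual.Additive.PerrinRiouUnit

end
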